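import Summits.ResolutionOfSingularities.ResolutionOfSingularities.Theorems.EquisingularLiftEquisingularLiftNatTowerBTransportFour
import Summits.ResolutionOfSingularities.ResolutionOfSingularities.Theorems.EquisingularLiftEquisingularLiftNatTransversalHasSNCWithOfTrace
import Summits.ResolutionOfSingularities.ResolutionOfSingularities.Theorems.EquisingularLiftEquisingularLiftNatTransversalStrictTransformTraceSlim
import Summits.ResolutionOfSingularities.ResolutionOfSingularities.Theorems.EquisingularLiftEquisingularLiftNatSubchainSupplierInvSLDefs
import HarnessLib

/-!
# [OURS · L1 W4.5(b) · EL♮(3) · T23-A‴ (U6)] AN IN-CARRIER PLANE THROUGH THE CARRIER ROUND: `Tower.exc₄_plane_curveStep`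
# (res-L1-w45b-lead-2's (D‴6) seed guard 0c6a341d172f5c17: a plane `P ∈ Ps₉` crossed TRANSVERSALLY by the carrier curve `Z₉` at every point of
# `Z₉ ∩ P` — stalkwise (T1) ∧ (T2) — enters `Es₁₀` WITH ITS MODEL; res-L1-w45b-stub-4's ENGINE WORD v1.2 d02b1fbd6b6fb5d2 §3 (U6))

res-type-027 g18 ((U6) owner), brick (F6b). OURS; NOT a statement of any manuscript ([Hironaka2017] is a candidate under adjudication, nothing of
it is asserted); AI-written, weaker than expert review. No `sorry`; standard axioms; DEF-FREE; `--supports stmt-ResolutionOfSingularities-20148 --as helper`.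

WHAT. In the carrier stage `(X, σ, jG)` let `P ⊆ F₉` be a closed in-carrier plane with `TCPlus.LetterDatum … F₉ X σ jG P` (model `𝓛`), `T₉ ⊄ P`, and let
`τ : X₂ = Bl_C X → X` be the carrier round's upstairs blow-up (`C·𝒪_{F₉} = 𝓘⟨Z₉⟩`, `V(C)` regular and `O`-flat, `C ≠ ⊥`), `υ' = Bl_{Z₉}`, `(j₂, t₂)` the new
model square. If `Z₉` crosses `P` transversally at every point of `Z₉ ∩ P` ((T1) ∧ (T2)), then `St P := closure υ'⁻¹(P ∖ Z₉)` is closed, `St T₉ ⊄ St P`,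
and `St P` carries `Tower.Exc₄ … F₁₀ (𝟙 F₁₀) (St P) hF' ∅ X₂ (τ ≫ σ) j₂` with model `St_C 𝓛`: snc by res-L1-w45b-lead-2's (A′-1)
`hasSNCWith_member_centre_of_trace_transversal` (p608670), trace by res-L1-w45b-stub-2's (A′-3) `comap_strictTransformIdeal_eq_vanishingIdeal_of_transversal'`,
principal stalks / regularity / position by res-L1-w45b-stub-4's B-TRACE internals (`isPrincipal_stalkIdeal_strictTransformIdeal`,
`isRegular_subscheme_strictTransformIdeal_of_hasSNCWith`, `support_strictTransformIdeal_subset`), the `Ruled` datum by the stand-in `hRuledP`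
(discharged at `FE` by T-STFLAT-GEN in …NatTowerCurveStepBSL), shadow forgotten.
[cite: GortzWedhorn2020, Prop. 13.91 and (13.19)] [cite: Liu2002, Thm. 8.1.19] [cite: StacksProject, Tag 0BIQ]
-/

set_option linter.dupNamespace false -- mandated namespace `Summit.<Summit>.<Problem>` of this single-conjunct summit
set_option linter.overlappingInstances false -- signatures carry `[IsDomain O] [IsDiscreteValuationRing O]`

noncomputable section

open CategoryTheory CategoryTheory.Limits AlgebraicGeometry TopologicalSpace Topology IsLocalRing
open Literature.AlgebraicGeometry.Resolution
open AlgebraicGeometry.Scheme.IdealSheafData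
open Summit.ResolutionOfSingularities.ResolutionOfSingularities.Theses.EquisingularLift.Split
open Summit.ResolutionOfSingularities.ResolutionOfSingularities.Cruxes.EquisingularLift.StrataSplit

namespace Summit.ResolutionOfSingularities.ResolutionOfSingularities.Cruxes.EquisingularLiftNat.Sections

/-- **An in-carrier plane through the carrier round, transversal case** (see the module docstring). [cite: GortzWedhorn2020, Prop. 13.91 and (13.19)]
[cite: Liu2002, Thm. 8.1.19] [OURS · L1 W4.5b · T23-A‴ (U6)] brick (F6b) (stmt-ResolutionOfSingularities-20148); NOT a statement of the manuscript. -/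
theorem Tower.exc₄_plane_curveStep (O : Type) [CommRing O] [IsDomain O] [IsDiscreteValuationRing O] {k : Type} [Field k] {θ : O →+* k}
    (hθ : Function.Surjective θ) (P : Scheme.{0}) (q : P ⟶ Spec (.of O)) (Y : Set P) (Ruled : Tower.RuledDatum P)
    {F₉ : Scheme.{0}} [IsLocallyNoetherian F₉] {Z₉ : Set F₉} {hZ₉ : IsClosed Z₉} {F₁₀ : Scheme.{0}} {υ' : F₁₀ ⟶ F₉}
    (hυ' : IsBlowup υ' (vanishingIdeal ⟨Z₉, hZ₉⟩))
    {X X₂ : Scheme.{0}} [IsIntegral X] [IsLocallyNoetherian X] [IsLocallyNoetherian X₂] (hXreg : Scheme.IsRegular X) {σ : X ⟶ P}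
    [IsProper (σ ≫ q)] {jG : F₉ ⟶ X} {tG : F₉ ⟶ Spec (.of k)} (hsq : IsPullback jG tG (σ ≫ q) (Spec.map (CommRingCat.ofHom θ)))
    {C : X.IdealSheafData} (hC : C.comap jG = vanishingIdeal ⟨Z₉, hZ₉⟩) (hCreg : Scheme.IsRegular C.subscheme)
    (hCflat : Flat (C.subschemeι ≫ σ ≫ q)) (hC0 : C ≠ ⊥)
    {τ : X₂ ⟶ X} (hτ : IsBlowup τ C) {j₂ : F₁₀ ⟶ X₂} {t₂ : F₁₀ ⟶ Spec (.of k)}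
    (hsq₂ : IsPullback j₂ t₂ ((τ ≫ σ) ≫ q) (Spec.map (CommRingCat.ofHom θ))) (hcomm : j₂ ≫ τ = υ' ≫ jG)
    -- STAND-IN (discharged at `FE` by T-STFLAT-GEN): the `Ruled` datum of a strict transform
    (hRuledP : ∀ (F' : Set F₁₀) (𝓕 : X.IdealSheafData), Flat (𝓕.subschemeι ≫ σ ≫ q) →
      Ruled F₉ Z₉ hZ₉ F₁₀ υ' F₁₀ (𝟙 F₁₀) F' X₂ (τ ≫ σ) j₂ (strictTransformIdeal τ C 𝓕))
    {T₉ : Set F₉} (hTirr : IsIrreducible T₉) (hTZ : ¬ T₉ ⊆ Z₉)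
    {Pl : Set F₉} (hPl : IsClosed Pl) (hL : TCPlus.LetterDatum O P q Y F₉ X σ jG Pl) (hTP : ¬ T₉ ⊆ Pl)
    (hT1 : ∀ g ∈ Z₉ ∩ Pl, stalkIdeal (vanishingIdeal (⟨Z₉, hZ₉⟩ : Closeds F₉)) g ⊔ stalkIdeal (vanishingIdeal (⟨Pl, hPl⟩ : Closeds F₉)) g =
      maximalIdeal (F₉.presheaf.stalk g))
    (hT2 : ∀ g ∈ Z₉ ∩ Pl, stalkIdeal (vanishingIdeal (⟨Z₉, hZ₉⟩ : Closeds F₉)) g ≠ maximalIdeal (F₉.presheaf.stalk g)) :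
    (IsClosed (closure (υ' ⁻¹' (Pl \ Z₉))) ∧ ¬ closure (υ' ⁻¹' (T₉ \ Z₉)) ⊆ closure (υ' ⁻¹' (Pl \ Z₉))) ∧
      ∀ hF' : IsClosed (closure (υ' ⁻¹' (Pl \ Z₉))),
        Tower.Exc₄ O P q Y Ruled Z₉ hZ₉ υ' F₁₀ (𝟙 F₁₀) (closure (υ' ⁻¹' (Pl \ Z₉))) hF' ∅ X₂ (τ ≫ σ) j₂ := by
  obtain ⟨𝓛, hl1, hl2, hl3, hl4, hl5⟩ := hL
  have hPc : (⟨closure Pl, isClosed_closure⟩ : Closeds F₉) = ⟨Pl, hPl⟩ := Closeds.ext hPl.closure_eq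
  rw [hPc] at hl1
  -- the model is non-zero (`T₉ ⊄ P`)
  have h𝓛0 : 𝓛 ≠ ⊥ := by
    rintro rfl
    apply hTP
    have h1 : (vanishingIdeal (⟨Pl, hPl⟩ : Closeds F₉) : F₉.IdealSheafData) = ⊥ := by
      rw [← hl1, Scheme.IdealSheafData.comap_bot]
    have h2 : ((vanishingIdeal (⟨Pl, hPl⟩ : Closeds F₉) : F₉.IdealSheafData).support : Set F₉) = Set.univ := by
      rw [h1, Scheme.IdealSheafData.support_bot]; rfl
    rw [Scheme.IdealSheafData.coe_support_vanishingIdeal] at h2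
    change Pl = Set.univ at h2
    rw [h2]; exact Set.subset_univ _
  -- (A′-1) snc of the plane's model with the centre
  have hE : HasSNCWith [𝓛] C := hasSNCWith_member_centre_of_trace_transversal hXreg hsq hθ hC hCreg hl1 hl2 hl3 h𝓛0 hT1 hT2
  have hsuppZ : (((vanishingIdeal ⟨Z₉, hZ₉⟩ : F₉.IdealSheafData)).support : Set F₉) ⊆ Z₉ := by
    rw [Scheme.IdealSheafData.coe_support_vanishingIdeal]; exact le_rfl
  refine ⟨⟨isClosed_closure, not_closure_preimage_diff_subset hυ' hTirr hPl hZ₉ hTP hTZ hsuppZ⟩, fun hF' =>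
    ⟨strictTransformIdeal τ C 𝓛, ?_, fun z => isPrincipal_stalkIdeal_strictTransformIdeal hXreg hCreg hτ hC0 𝓛 hl2 z,
      isRegular_subscheme_strictTransformIdeal_of_hasSNCWith hE hτ, ?_, hRuledP _ 𝓛 hl5, Or.inl rfl⟩⟩
  · -- (e-i) the trace (A′-3)
    exact comap_strictTransformIdeal_eq_vanishingIdeal_of_transversal' hsq hθ hτ hυ' hcomm hsq₂ hC hCflat hT1 hT2 hl1 hE
  · -- (e-iv) off the generic point of `Y`: `supp St ⊆ τ⁻¹ supp 𝓛`
    rintro _ ⟨z, hz, rfl⟩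
    have hz' : τ z ∈ (𝓛.support : Set X) := by
      have h1 := support_strictTransformIdeal_subset τ C 𝓛 hz
      have hcl : closure (τ ⁻¹' ((𝓛.support : Set X) \ (C.support : Set X))) ⊆ τ ⁻¹' (𝓛.support : Set X) :=
        closure_minimal (fun w hw => hw.1) (𝓛.support.isClosed.preimage τ.continuous)
      exact hcl h1
    rw [Scheme.Hom.comp_apply]
    exact hl4 ⟨τ z, hz', rfl⟩

end Summit.ResolutionOfSingularities.ResolutionOfSingularities.Cruxes.EquisingularLiftNat.Sections

end
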